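import Summits.QuantumFields.QCD.Theorems.QuarksAsStableActionCriticalLineDiamagnetismCheckerEvalSound

/-!
# Block-margin certificate checker — soundness of the leaf test, part B (crux stmt-QuantumFields-9734, lead c3)

* `mem_tForm`, `mem_bubForm`, **`mem_entryForm`**: the entry forms enclose the closed form `blockHc C (bitsFun bs) μ ν`
  at every point of the box (the real closed form regrouped as the forms compute it: a `ring` identity);
* `loQ_le` (forms ⇒ rational enclosures), active-axis bookkeeping (`actList`, `sum_act`), **`blockOKbits_sound`**
  (the per-block test proves `BlockMargin γ C (bitsFun bs)`; classes with `≤ 1` active axis are trivial),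
  **`leafOK_sound`**, and **`region_sound`**: `certifyRegion γ fuel r = true` (`r ≤ 3`) implies
  `∀ C, InRegion r C → ∀ s, BlockMargin γ C s` (chamber reduction + root coverage + bisection driver + leaf test).

Pure theorem file; no definitions, no facts, no axioms.
-/

namespace Summit.QuantumFields.QCD.Cruxes.CriticalLineDiamagnetism.ChessboardCellGain.Checker

open Finset
/-! ## Soundness, part 3: entries, blocks, leaves, regions -/

section EvalSound3

open Literature.Analysis.ValidatedNumerics

/-- Membership is invariant under rewriting the enclosed real. -/
theorem mem_congr' {S : ℕ} {ε : ℕ → ℝ} {x y : ℝ} {F : AForm} (h : x = y) (hy : AForm.mem S ε y F) :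
    AForm.mem S ε x F := h ▸ hy

/-- Soundness of the bubble numerator forms. -/
theorem mem_tForm {X : Ctx} {C : Fin 4 → ℝ} {ε : ℕ → ℝ} (hXs : CtxSound X C ε) (hval : AForm.Valid ε)
    {b bs : ℕ} (hb : b < 16) (hbs : bs < 16) (μ ν : Fin 4) :
    AForm.mem SC ε (tB C (bitsFun b) (bitsFun bs) μ ν) (tForm X b bs μ ν) := by
  have hb' : b ^^^ bs < 16 := xor_lt_16 hb hbs
  -- the grouped real value mirrored by the form
  have hbase : AForm.mem SC ε
      ((aW C (bitsFun b) * aW C (bitsFun (b ^^^ bs)) - wS C (bitsFun bs)) *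
          (((sgnZ b μ * sgnZ b ν : ℤ) : ℝ) * (C μ * C ν)) +
        (aW C (bitsFun b) - aW C (bitsFun (b ^^^ bs))) *
          (((sgnZ b μ : ℤ) : ℝ) * (C μ * s2 C ν) + ((sgnZ b ν : ℤ) : ℝ) * (C ν * s2 C μ)) -
        ((2 : ℤ) : ℝ) * (s2 C μ * s2 C ν))
      (AForm.sub
        (AForm.add (AForm.mul SC (AForm.sub (lget X.aa (16 * b + (b ^^^ bs))) (lget X.w bs))
          (AForm.mulInt (sgnZ b μ * sgnZ b ν) (lget X.cc (4 * μ + ν))))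
          (AForm.mul SC (AForm.sub (lget X.a b) (lget X.a (b ^^^ bs)))
            (AForm.add (AForm.mulInt (sgnZ b μ) (lget X.cq (4 * μ + ν)))
              (AForm.mulInt (sgnZ b ν) (lget X.cq (4 * ν + μ))))))
        (AForm.mulInt 2 (lget X.qq (4 * μ + ν)))) :=
    AForm.mem_sub
      (AForm.mem_add
        (AForm.mem_mul (by decide : 0 < SC) hval (AForm.mem_sub (hXs.aa b hb _ hb') (hXs.w bs hbs))
          (AForm.mem_mulInt _ (hXs.cc μ ν)))
        (AForm.mem_mul (by decide : 0 < SC) hval (AForm.mem_sub (hXs.a b hb) (hXs.a _ hb'))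
          (AForm.mem_add (AForm.mem_mulInt _ (hXs.cq μ ν)) (AForm.mem_mulInt _ (hXs.cq ν μ)))))
      (AForm.mem_mulInt _ (hXs.qq μ ν))
  have hsg : ∀ κ : Fin 4, sgn (bitsFun b) κ = (sgnZ b κ : ℝ) := sgn_bitsFun b
  have hqμ : AForm.mem SC ε (s2 C μ) (lget X.q μ) := by
    have := hXs.q μ μ.2; unfold s2; rwa [Cn_fin] at this
  unfold tForm tB
  rw [bitsFun_xor_nat hb hbs]
  by_cases hμν : μ = ν
  · subst hμν
    simp only [if_true]
    refine mem_congr' ?_ (AForm.mem_add hbase (AForm.mem_mul (by decide : 0 < SC) hval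
      (AForm.mem_sub (AForm.mem_neg (hXs.aa b hb _ hb')) (hXs.w bs hbs)) hqμ))
    rw [hsg]; push_cast; ring
  · have hne : (μ : ℕ) ≠ (ν : ℕ) := fun h => hμν (Fin.ext h)
    simp only [hμν, hne, if_false]
    refine mem_congr' ?_ hbase
    rw [hsg, hsg]; push_cast; ring

/-- Soundness of the bubble forms. -/
theorem mem_bubForm {X : Ctx} {C : Fin 4 → ℝ} {ε : ℕ → ℝ} (hXs : CtxSound X C ε) (hval : AForm.Valid ε)
    {bs : ℕ} (hbs : bs < 16) (μ ν : Fin 4) :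
    AForm.mem SC ε (∑ σ : Fin 4 → ZMod 2, 2 * tB C σ (bitsFun bs) μ ν / (hW C σ * hW C (σ + bitsFun bs)))
      (bubForm X bs μ ν) := by
  unfold bubForm
  rw [sum_class_eq_sum_range]
  refine mem_asum_range (by decide : 0 < SC) 16 _ (fun b => 2 * tB C (bitsFun b) (bitsFun bs) μ ν /
    (hW C (bitsFun b) * hW C (bitsFun b + bitsFun bs))) fun b hb => ?_
  have hb' : b ^^^ bs < 16 := xor_lt_16 hb hbs
  refine mem_congr' ?_ (AForm.mem_mulInt 2 (AForm.mem_mul (by decide : 0 < SC) hval (mem_tForm hXs hval hb hbs μ ν)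
    (hXs.ihp b hb _ hb')))
  rw [bitsFun_xor_nat hb hbs]
  push_cast
  rw [div_eq_mul_inv, mul_inv]
  ring

/-- **Soundness of the entry forms**: `entryForm X bs μ ν` encloses `blockHc C (bitsFun bs) μ ν`. -/
theorem mem_entryForm {X : Ctx} {C : Fin 4 → ℝ} {ε : ℕ → ℝ} (hXs : CtxSound X C ε) (hval : AForm.Valid ε)
    {bs : ℕ} (hbs : bs < 16) (μ ν : Fin 4) :
    AForm.mem SC ε (blockHc C (bitsFun bs) μ ν) (entryForm X bs μ ν) := by
  unfold entryForm blockHc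
  refine AForm.mem_add ?_ (mem_bubForm hXs hval hbs μ ν)
  by_cases hμν : μ = ν
  · subst hμν; simp only [if_true]; exact hXs.tad μ
  · have hne : (μ : ℕ) ≠ (ν : ℕ) := fun h => hμν (Fin.ext h)
    simp only [hμν, hne, if_false]
    have := AForm.mem_const (ε := ε) (by decide : 0 < SC) 0
    simpa using this

/-! ### From forms to rational enclosures -/

/-- A form yields rational lower and upper bounds of the enclosed real. -/
theorem loQ_le {ε : ℕ → ℝ} (hval : AForm.Valid ε) {x : ℝ} {F : AForm} (hx : AForm.mem SC ε x F) :
    ((loQ F : ℚ) : ℝ) ≤ x ∧ x ≤ ((hiQ F : ℚ) : ℝ) := by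
  have h := AForm.abs_sub_le_rad hval hx
  rw [abs_le] at h
  have hS : (0 : ℝ) < SC := by exact_mod_cast (by decide : 0 < SC)
  unfold loQ hiQ
  push_cast
  constructor
  · rw [div_le_iff₀ hS]; linarith
  · rw [le_div_iff₀ hS]; linarith

/-! ### Active-axis bookkeeping -/

/-- Membership in `actList` is activity of the axis. -/
theorem mem_actList {bs : ℕ} {μ : Fin 4} : μ ∈ actList bs ↔ bitsFun bs μ = 1 := by
  unfold actList bitsFun
  simp only [List.mem_filter, List.mem_finRange, true_and]
  constructor
  · intro h; rw [if_pos h]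
  · intro h; by_contra hc; rw [if_neg hc] at h; exact absurd h (by decide)

/-- `actList` has no duplicates. -/
theorem nodup_actList (bs : ℕ) : (actList bs).Nodup := (List.nodup_finRange 4).filter _

/-- `actList` as a finset is the active set. -/
theorem toFinset_actList (bs : ℕ) :
    (actList bs).toFinset = Finset.univ.filter fun μ : Fin 4 => bitsFun bs μ = 1 := by
  ext μ; simp [mem_actList]

/-- `actList` has `nAct` elements. -/
theorem length_actList (bs : ℕ) : (actList bs).length = nAct (bitsFun bs) := by
  unfold nAct
  rw [← toFinset_actList, List.toFinset_card_of_nodup (nodup_actList bs)]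

/-- A list sum as a sum over positions. -/
theorem List.sum_map_eq_sum_range_getD' {α : Type*} (l : List α) (f : α → ℝ) (d : α) :
    (l.map f).sum = ∑ i ∈ Finset.range l.length, f (l.getD i d) := by
  induction l with
  | nil => simp
  | cons a l ih =>
    rw [List.map_cons, List.sum_cons, List.length_cons, Finset.sum_range_succ', ih]
    simp [add_comm]

/-- Sums over the active axes as sums over positions in `actList`. -/
theorem sum_act (bs : ℕ) (f : Fin 4 → ℝ) (hf : ∀ μ, bitsFun bs μ = 0 → f μ = 0) :
    ∑ i ∈ Finset.range (actList bs).length, f ((actList bs).getD i 0) = ∑ μ, f μ := by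
  rw [← List.sum_map_eq_sum_range_getD', ← List.sum_toFinset _ (nodup_actList bs), toFinset_actList,
    Finset.sum_filter]
  refine Finset.sum_congr rfl fun μ _ => ?_
  split_ifs with h
  · rfl
  · have h01 : ∀ a : ZMod 2, a ≠ 1 → a = 0 := by decide
    exact (hf μ (h01 _ h)).symm

/-- Access to a mapped range (general default). -/
theorem getD_map_range {α : Type*} (g : ℕ → α) {n t : ℕ} (ht : t < n) (d : α) :
    ((List.range n).map g).getD t d = g t := by
  rw [List.getD_eq_getElem?_getD, List.getElem?_map, List.getElem?_range ht]; rfl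

/-! ### The per-block test at a point -/

/-- **Soundness of `blockOKbits`** for a class with at least two active axes. -/
theorem blockOKbits_sound {γ : ℚ} {X : Ctx} {C : Fin 4 → ℝ} {ε : ℕ → ℝ} (hXs : CtxSound X C ε)
    (hval : AForm.Valid ε) {bs : ℕ} (hbs : bs < 16) (hok : blockOKbits γ X bs = true)
    (hn : 2 ≤ (actList bs).length) : BlockMargin (γ : ℝ) C (bitsFun bs) := by
  set act := actList bs with hact
  set n := act.length with hn'
  set s := bitsFun bs with hs
  -- the real kernel on positions
  set Hm : ℕ → ℕ → ℝ := fun i j => blockHc C s (act.getD i 0) (act.getD j 0) with hHm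
  have hsym : ∀ i j, Hm i j = Hm j i := fun i j => blockHc_symm C s _ _
  -- unfold the test
  have hok' : blockOK γ n (fun i j => ((entryTable X bs).map loQ).getD (i * n + j) 0)
      (fun i j => ((entryTable X bs).map hiQ).getD (i * n + j) 0) = true := by
    unfold blockOKbits at hok
    rw [if_neg (not_lt.2 hn)] at hok
    exact hok
  -- enclosures
  have henc : ∀ i j, i < n → j < n →
      ((((entryTable X bs).map loQ).getD (i * n + j) 0 : ℚ) : ℝ) ≤ Hm i j ∧
        Hm i j ≤ ((((entryTable X bs).map hiQ).getD (i * n + j) 0 : ℚ) : ℝ) := by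
    intro i j hi hj
    have ht : i * n + j < n * n := by nlinarith
    have hdiv : (i * n + j) / n = i := by
      rw [Nat.add_comm, Nat.add_mul_div_right _ _ (by omega), Nat.div_eq_of_lt hj]; omega
    have hmod : (i * n + j) % n = j := by
      rw [Nat.add_comm, Nat.add_mul_mod_self_right, Nat.mod_eq_of_lt hj]
    -- the table entry
    have hmm : min i j * n + max i j < n * n := by
      rcases le_total i j with h | h
      · rw [min_eq_left h, max_eq_right h]; nlinarith
      · rw [min_eq_right h, max_eq_left h]; nlinarith
    have hmin : min i j ≤ max i j := min_le_max
    have hdiv2 : (min i j * n + max i j) / n = min i j := by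
      rw [Nat.add_comm, Nat.add_mul_div_right _ _ (by omega), Nat.div_eq_of_lt (by
        rcases le_total i j with h | h <;> simp [h, hi, hj])]; omega
    have hmod2 : (min i j * n + max i j) % n = max i j := by
      rw [Nat.add_comm, Nat.add_mul_mod_self_right, Nat.mod_eq_of_lt (by
        rcases le_total i j with h | h <;> simp [h, hi, hj])]
    have htab : (entryTable X bs).getD (i * n + j) (AForm.const 0) =
        entryForm X bs (act.getD (min i j) 0).val (act.getD (max i j) 0).val := by
      unfold entryTable
      rw [getD_map_range _ ht]
      simp only []
      rw [hdiv, hmod]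
      unfold lget
      rw [getD_map_range _ hmm, hdiv2, hmod2, if_pos hmin]
    have hmemE : AForm.mem SC ε (Hm i j) ((entryTable X bs).getD (i * n + j) (AForm.const 0)) := by
      rw [htab, hHm]
      have key := mem_entryForm hXs hval hbs (act.getD (min i j) 0) (act.getD (max i j) 0)
      refine mem_congr' ?_ key
      simp only []
      rcases le_total i j with h | h
      · rw [min_eq_left h, max_eq_right h]
      · rw [min_eq_right h, max_eq_left h, blockHc_symm]
    have hb := loQ_le hval hmemE
    have e1 : ((entryTable X bs).map loQ).getD (i * n + j) 0 = loQ ((entryTable X bs).getD (i * n + j) (AForm.const 0)) := by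
      rw [show (0 : ℚ) = loQ (AForm.const 0) by simp [loQ, AForm.const, AForm.rad, AForm.absSum], List.getD_map]
    have e2 : ((entryTable X bs).map hiQ).getD (i * n + j) 0 = hiQ ((entryTable X bs).getD (i * n + j) (AForm.const 0)) := by
      rw [show (0 : ℚ) = hiQ (AForm.const 0) by simp [hiQ, AForm.const, AForm.rad, AForm.absSum], List.getD_map]
    rw [e1, e2]
    exact hb
  -- apply the block test soundness
  refine ⟨fun y hy0 hsum => ?_⟩
  have hyv : ∀ μ, bitsFun bs μ = 0 → y μ = 0 := hy0
  have key := blockOK_sound n γ _ _ Hm hsym henc hok' (fun i => y (act.getD i 0))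
    (by rw [sum_act bs y hyv]; exact hsum)
  -- translate positions back to axes
  have e1 : ∑ i ∈ Finset.range n, y (act.getD i 0) ^ 2 = ∑ μ, y μ ^ 2 :=
    sum_act bs (fun μ => y μ ^ 2) fun μ hμ => by rw [hyv μ hμ]; ring
  have e2 : ∑ i ∈ Finset.range n, ∑ j ∈ Finset.range n, y (act.getD i 0) * Hm i j * y (act.getD j 0) =
      ∑ μ, ∑ ν, blockHc C s μ ν * (y μ * y ν) := by
    have inner : ∀ i, ∑ j ∈ Finset.range n, y (act.getD i 0) * Hm i j * y (act.getD j 0) =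
        ∑ ν, blockHc C s (act.getD i 0) ν * (y (act.getD i 0) * y ν) := fun i => by
      rw [← sum_act bs (fun ν => blockHc C s (act.getD i 0) ν * (y (act.getD i 0) * y ν))
        (fun ν hν => by rw [hyv ν hν]; ring)]
      exact Finset.sum_congr rfl fun j _ => by rw [hHm]; ring
    simp_rw [inner]
    exact sum_act bs (fun μ => ∑ ν, blockHc C s μ ν * (y μ * y ν)) fun μ hμ => by
      simp [hyv μ hμ]
  rw [e1, e2] at key
  rw [hn', hact, length_actList, ← hs] at key
  linarith

/-- Classes with at most one active axis: the statement is trivial (`y = 0`). -/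
theorem blockMargin_of_nAct_le_one {γ : ℝ} {C : Fin 4 → ℝ} {s : Fin 4 → ZMod 2} (hn : nAct s ≤ 1) :
    BlockMargin γ C s := by
  refine ⟨fun y hy0 hsum => ?_⟩
  have hy : ∀ μ, y μ = 0 := by
    set A := Finset.univ.filter fun μ : Fin 4 => s μ = 1 with hA
    have h01 : ∀ a : ZMod 2, a ≠ 1 → a = 0 := by decide
    have hoff : ∀ μ, μ ∉ A → y μ = 0 := fun μ hμ =>
      hy0 μ (h01 _ fun h1 => hμ (Finset.mem_filter.2 ⟨Finset.mem_univ _, h1⟩))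
    have hsumA : ∑ μ ∈ A, y μ = 0 := by
      rw [← hsum, ← Finset.sum_subset (Finset.subset_univ A) fun μ _ hμ => hoff μ hμ]
    intro μ
    by_cases hμ : μ ∈ A
    · have hcard : A.card ≤ 1 := hn
      have hA1 : A = {μ} := Finset.eq_singleton_iff_unique_mem.2
        ⟨hμ, fun ν hν => Finset.card_le_one.1 hcard ν hν μ hμ⟩
      rw [hA1, Finset.sum_singleton] at hsumA
      exact hsumA
    · exact hoff μ hμ
  simp [hy]

/-- **Soundness of the leaf test.** -/
theorem leafOK_sound (γ : ℚ) (B : IBox) (h : leafOK γ B = true) (C : Fin 4 → ℝ) (hC : IBox.mem SC B C) :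
    ∀ s, BlockMargin (γ : ℝ) C s := by
  intro s
  unfold leafOK at h
  split at h
  · exact absurd h Bool.false_ne_true
  · rename_i X hX
    have hXs := mkCtx_sound hX hC
    have hval := noise_valid B C hC
    obtain ⟨b, hb⟩ := bitsFun_bijective.2 s
    rw [← hb]
    by_cases hn : 2 ≤ (actList b.val).length
    · rw [List.all_eq_true] at h
      exact blockOKbits_sound hXs hval b.2 (h b.val (List.mem_range.2 b.2)) hn
    · exact blockMargin_of_nAct_le_one (by rw [← length_actList]; omega)

/-- **Soundness of a region certificate**: if `certifyRegion γ fuel r = true` (`r ≤ 3`) then every point of region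
`r` satisfies all block margins with constant `γ`. -/
theorem region_sound (γ : ℚ) (fuel r : ℕ) (hr : r ≤ 3) (h : certifyRegion γ fuel r = true) :
    ∀ C, InRegion r C → ∀ s, BlockMargin (γ : ℝ) C s := by
  unfold certifyRegion at h
  rw [List.all_eq_true] at h
  exact margin_of_certify SC γ (leafOK γ) (leafOK_sound γ) fuel (roots r) h (InRegion r)
    (fun C τ hC => hC.reflect τ) (fun C π hC => hC.perm π) fun C hC => mem_roots hr hC



end EvalSound3

/-- **Registered helper `stub_checkerRegionSound`** (= `region_sound`). -/
theorem stub_checkerRegionSound : ∀ (γ : ℚ) (fuel r : ℕ), r ≤ 3 → certifyRegion γ fuel r = true → ∀ (C : Fin 4 → ℝ), InRegion r C → ∀ (s : Fin 4 → ZMod 2), BlockMargin (γ : ℝ) C s :=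
  region_sound

end Summit.QuantumFields.QCD.Cruxes.CriticalLineDiamagnetism.ChessboardCellGain.Checker
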